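import Summits.QuantumFields.GaugeBoot.DiagonalRPTorusPlaquetteSign
import Summits.QuantumFields.GaugeBoot.DiagonalRPTorusOdd
import HarnessLib

/-!
# Closed-half diagonal RP on the two-dimensional torus: the classification for ALL real `β`
(gauge-boot, task L3(θ′), 2/2)

HONEST FRAMING (cell `pub-gaugeboot`, page 1 of every file): the venture produces certified bounds
on lattice expectations at stated coupling, gauge group, dimension and torus size; NOT a mass gap,
NOT a continuum limit, NOT a string tension; NOT Yang–Mills-summit-bearing (barriers
`FixedCouplingUltralocality`, `PerturbativeInvisibility`). This module is a small structural
result about which positivity constraints a two-dimensional TORUS certificate may use (no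
certificate of the cell sits at `β < 0`); it discharges nothing else.

## Content (all declarations in `Summit.QuantumFields.GaugeBoot.DiagRPTwo`)

`DiagonalRPTorusOdd.lean` (L3(θ)) classified closed-half diagonal reflection positivity
`DiagonalReflectionPositive ρ β i j` on `(ℤ/L)²`, `L ≥ 3`, for `β ≥ 0`:
`↔ (Odd L ∨ β = 0)`. `DiagonalRPTorusPlaquetteSign.lean` (1/2) shows that closed-half diagonal RP
forces `⟨Re tr ρ(U_p)⟩ ≥ 0` and therefore fails at every `β < 0` whenever a central element acts by
a non-trivial scalar. Hence:

* **`diagonalReflectionPositive_two_iff`** — `(ℤ/L)²`, `L ≥ 3`, `G` compact metrisable, `ρ`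
  continuous (`N ≥ 1`) with a central `z`, `ρ z = ω • 1`, `ω ≠ 1`, `i ≠ j`, EVERY real `β`:
  `DiagonalReflectionPositive ρ β i j ↔ (Odd L ∧ 0 ≤ β) ∨ β = 0`; model instances
  `…_specialUnitary` (`G ≅ SU(N)`, `N ≥ 2`), `…_unitary` (`G ≅ U(N)`, `N ≥ 1`), and the matrix
  groups themselves `…_suN`, `…_uN`.
* **`wilsonExpectation_re_trace_plaquette_nonneg_odd`** — a by-product in the positive direction:
  on every ODD two-torus `L ≥ 3`, at every `β ≥ 0`, for EVERY continuous `ρ` of every compact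
  metrisable `G` (no centre hypothesis, reducible `ρ` allowed), `0 ≤ ⟨Re tr ρ(U_{x;ij})⟩_{Λ,β}` for
  every plaquette — L3(θ) (`diagonalReflectionPositive_two_odd`) composed with
  `wilsonExpectation_re_trace_plaquette_nonneg_of_diagonalReflectionPositive'`. (For `ρ` with a
  non-trivial central scalar the tree has the sharper `> 0` at `β > 0` on every torus,
  `wilsonExpectation_re_trace_plaquette_pos`; the point here is the absence of any hypothesis
  on `ρ`.)

So on the square two-torus the diagonal swap is a reflection positivity EXACTLY on odd tori at
`β ≥ 0` (plus the trivial `β = 0`): the even-`L` failure is dynamical at both signs of `β`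
(L3(δ)), the odd-`L` failure at `β < 0` is the sign of the plaquette.

## What is NOT claimed

The gauge-invariant sector at `β < 0` (open transports are gauge-variant witnesses); `L = 2`
(false for every `β`, `not_diagonalReflectionPositive_two_two`); `L = 1`; `d ≥ 3` (see 1/2 and the
`DiagRPThree` / `DiagRPSUN` / `…HighDim…` files).

References: K. Osterwalder, E. Seiler, Ann. Phys. 110 (1978) 440, §2; J. Fröhlich, R. Israel,
E. H. Lieb, B. Simon, Commun. Math. Phys. 62 (1978) 1, Thm. 2.1; V. Kazakov, Z. Zheng,
arXiv:2203.11360 §3.1. Elementary; not in print as far as the cell's searches go.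
-/

open MeasureTheory Complex Finset Function
open scoped ComplexOrder

namespace Summit.QuantumFields.GaugeBoot

open Literature.MathematicalPhysics.QuantumFieldTheory
open Literature.RepresentationTheory.CompactGroups

noncomputable section

/-! ## Two dimensions: the classification for all real `β` -/

namespace DiagRPTwo

variable {L N : ℕ} [NeZero L] {G : Type*} [Group G] [TopologicalSpace G] [IsTopologicalGroup G]
  [CompactSpace G] [MeasurableSpace G] [BorelSpace G] [SecondCountableTopology G]
  (ρ : G →* Matrix (Fin N) (Fin N) ℂ)

/-- ★ **On every ODD two-torus the mean plaquette character is non-negative at every `β ≥ 0`, for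
EVERY continuous representation of every compact metrisable group** (no centre hypothesis,
reducible `ρ` allowed): `0 ≤ ⟨Re tr ρ(U_{x;ij})⟩_{(ℤ/L)²,β}`, `L ≥ 3` odd — closed-half diagonal
RP holds there (L3(θ), `diagonalReflectionPositive_two_odd`) and forces it. -/
theorem wilsonExpectation_re_trace_plaquette_nonneg_odd (hL : Odd L) (h3 : 3 ≤ L)
    (hρ : Continuous ρ) {β : ℝ} (hβ : 0 ≤ β) (x : Site 2 L) {i j : Fin 2} (hij : i ≠ j) :
    0 ≤ wilsonExpectation ρ β
      (fun U : GaugeConfig 2 L G => (ρ (plaquetteHolonomy U x i j)).trace.re) := by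
  haveI : Fact (1 < L) := ⟨by omega⟩
  exact wilsonExpectation_re_trace_plaquette_nonneg_of_diagonalReflectionPositive' ρ hρ hij
    (diagonalReflectionPositive_two_odd ρ hL h3 hρ hβ hij) x hij

/-- ★★★ **THE `d = 2` CLASSIFICATION OF CLOSED-HALF DIAGONAL RP ON THE TORUS, ALL REAL `β`.**
`(ℤ/L)²`, `L ≥ 3`, `G` compact metrisable, `ρ` continuous (`N ≥ 1`) with a central `z` acting by
a scalar `ω ≠ 1`, `i ≠ j`, `β ∈ ℝ`:
`DiagonalReflectionPositive ρ β i j ↔ (Odd L ∧ 0 ≤ β) ∨ β = 0`.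
(`β ≥ 0`: `diagonalReflectionPositive_two_iff_odd_or_zero`; `β < 0`:
`not_diagonalReflectionPositive_of_neg`. `L = 2`: false for every `β`,
`not_diagonalReflectionPositive_two_two`; `L = 1` degenerate, not covered.) -/
theorem diagonalReflectionPositive_two_iff [T2Space G] [NeZero N] (h3 : 3 ≤ L) (hρ : Continuous ρ)
    {z : G} {ω : ℂ} (hω : ρ z = ω • (1 : Matrix (Fin N) (Fin N) ℂ)) (hne : ω ≠ 1) (β : ℝ)
    {i j : Fin 2} (hij : i ≠ j) :
    DiagonalReflectionPositive (d := 2) (L := L) ρ β i j ↔ (Odd L ∧ 0 ≤ β) ∨ β = 0 := by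
  haveI : Fact (1 < L) := ⟨by omega⟩
  have hω1 : ‖ω‖ = 1 := norm_eq_one_of_map_eq_smul_one ρ hρ hω
  -- the character is not constant: `Re tr ρ(z) = N Re ω ≠ N`
  have hρN : ∃ g, ((ρ g).trace).re ≠ N := by
    refine ⟨z, ?_⟩
    have hre : ω.re < 1 := by
      have h1 : ω.re ≤ 1 := (Complex.re_le_norm ω).trans hω1.le
      refine lt_of_le_of_ne h1 fun hre => hne ?_
      have hsq : ω.re * ω.re + ω.im * ω.im = 1 := by
        rw [← Complex.normSq_apply, Complex.normSq_eq_norm_sq, hω1, one_pow]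
      have him : ω.im = 0 := by
        have : ω.im * ω.im = 0 := by rw [hre] at hsq; linarith
        exact mul_self_eq_zero.1 this
      exact Complex.ext (by simp [hre]) (by simp [him])
    have hN : (0 : ℝ) < N := by exact_mod_cast Nat.pos_of_ne_zero (NeZero.ne N)
    rw [hω, Matrix.trace_smul, Matrix.trace_one, smul_eq_mul, Fintype.card_fin, Complex.mul_re,
      Complex.natCast_re, Complex.natCast_im, mul_zero, sub_zero]
    intro h
    have : (1 - ω.re) * N = 0 := by linarith
    rcases mul_eq_zero.1 this with h' | h'
    · linarith
    · linarith
  rcases lt_or_ge β 0 with hβ | hβ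
  · constructor
    · intro hRP
      exact absurd hRP (not_diagonalReflectionPositive_of_neg ρ hρ hω hne hβ hij)
    · rintro (⟨-, h⟩ | h) <;> linarith
  · rw [diagonalReflectionPositive_two_iff_odd_or_zero ρ h3 hρ hρN hβ hij]
    constructor
    · rintro (h | h)
      · exact Or.inl ⟨h, hβ⟩
      · exact Or.inr h
    · rintro (⟨h, -⟩ | h)
      · exact Or.inl h
      · exact Or.inr h

/-- The classification for models `G ≅ SU(N)`, `N ≥ 2`. -/
theorem diagonalReflectionPositive_two_iff_specialUnitary [T2Space G] (hρ : IsSpecialUnitaryModel ρ)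
    (hN : 2 ≤ N) (h3 : 3 ≤ L) (β : ℝ) {i j : Fin 2} (hij : i ≠ j) :
    DiagonalReflectionPositive (d := 2) (L := L) ρ β i j ↔ (Odd L ∧ 0 ≤ β) ∨ β = 0 := by
  haveI : NeZero N := ⟨by omega⟩
  obtain ⟨z, ζ, hζ1, hz, -⟩ := IsSpecialUnitaryModel.exists_central ρ hρ hN
  exact diagonalReflectionPositive_two_iff ρ h3 hρ.1 hz hζ1 β hij

/-- The classification for models `G ≅ U(N)`, `N ≥ 1`. -/
theorem diagonalReflectionPositive_two_iff_unitary [T2Space G] (hρ : IsUnitaryModel ρ) (hN : 1 ≤ N)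
    (h3 : 3 ≤ L) (β : ℝ) {i j : Fin 2} (hij : i ≠ j) :
    DiagonalReflectionPositive (d := 2) (L := L) ρ β i j ↔ (Odd L ∧ 0 ≤ β) ∨ β = 0 := by
  haveI : NeZero N := ⟨by omega⟩
  obtain ⟨z, hz, -⟩ := IsUnitaryModel.exists_central ρ hρ
  have hz' : ρ z = (-1 : ℂ) • (1 : Matrix (Fin N) (Fin N) ℂ) := by rw [hz, neg_one_smul]
  exact diagonalReflectionPositive_two_iff ρ h3 hρ.1 hz' (by norm_num) β hij

end DiagRPTwo

/-! ## The concrete groups in two dimensions -/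

namespace DiagRPTwo

open Literature.MathematicalPhysics.QuantumLattice

/-- ★★★ **`SU(N)` on `(ℤ/L)²` (`N ≥ 2`, `L ≥ 3`, all real `β`)**: closed-half diagonal RP holds
iff (`L` odd and `β ≥ 0`) or `β = 0`. -/
theorem diagonalReflectionPositive_two_iff_suN {L N : ℕ} [NeZero L] (hN : 2 ≤ N) (h3 : 3 ≤ L)
    (β : ℝ) {i j : Fin 2} (hij : i ≠ j) :
    DiagonalReflectionPositive (d := 2) (L := L) (fundamentalRep (Fin N)) β i j ↔
      (Odd L ∧ 0 ≤ β) ∨ β = 0 := by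
  haveI : SecondCountableTopology (Matrix (Fin N) (Fin N) ℂ) :=
    inferInstanceAs (SecondCountableTopology (Fin N → Fin N → ℂ))
  haveI : SecondCountableTopology (Matrix.specialUnitaryGroup (Fin N) ℂ) :=
    Topology.IsEmbedding.subtypeVal.secondCountableTopology
  exact diagonalReflectionPositive_two_iff_specialUnitary (fundamentalRep (Fin N))
    (TorusAreaLaw.isSpecialUnitaryModel_fundamentalRep N) hN h3 β hij

/-- ★★★ **`U(N)` on `(ℤ/L)²` (`N ≥ 1`, `L ≥ 3`, all real `β`; `N = 1`: compact `U(1)`)**: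
closed-half diagonal RP holds iff (`L` odd and `β ≥ 0`) or `β = 0`. -/
theorem diagonalReflectionPositive_two_iff_uN {L N : ℕ} [NeZero L] (hN : 1 ≤ N) (h3 : 3 ≤ L)
    (β : ℝ) {i j : Fin 2} (hij : i ≠ j) :
    DiagonalReflectionPositive (d := 2) (L := L) (unitaryFundamentalRep (Fin N) ℂ) β i j ↔
      (Odd L ∧ 0 ≤ β) ∨ β = 0 := by
  haveI : SecondCountableTopology (Matrix.unitaryGroup (Fin N) ℂ) :=
    IsUnitaryModel.secondCountableTopology _ (isUnitaryModel_unitaryFundamentalRep N)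
  exact diagonalReflectionPositive_two_iff_unitary (unitaryFundamentalRep (Fin N) ℂ)
    (isUnitaryModel_unitaryFundamentalRep N) hN h3 β hij

end DiagRPTwo

end

end Summit.QuantumFields.GaugeBoot
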